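import Mathlib.MeasureTheory.Function.Jacobian
import Mathlib.Analysis.Calculus.Deriv.Inv
import Mathlib.MeasureTheory.Measure.Prod
import Mathlib.MeasureTheory.Function.StronglyMeasurable.Basic
import HarnessLib

/-!
# Crux `BlockLipschitzL` (stmt-QuantumFields-23533) ∕ `HistoryTailL` (stmt-QuantumFields-19936), LINE 25 «CompactnessTransfer»,
# stub S1″ — ROAD (H) «SU(2) currents ⇒ H-system ⇒ 8π quantum», brick (T) «CONE → PLANE TRANSPORT», FILE C «GOOD SLICES»

Cell `ym3-torus` (YM ladder rung R3 = continuum SU(2) Yang–Mills on T³ — a RUNG, NOT Clay: not d = 4, not infinite volume,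
not a mass gap); WIDTH helper seat `ym3-torus-px14` g7 (brick (T) of px19 g8's ROAD (H), architecture v1).  Helper
`--supports stmt-QuantumFields-23533`; THEOREMS ONLY (0 `def`, 0 `sorry`, default heartbeats); imports Mathlib only
(product measures and Fubini for almost-everywhere statements, the Jacobian null-set lemma).

WHAT THIS FILE PROVES — pure measure theory, the «de-coning» step of the link construction.  Let `Y` be a σ-finite measure
space, `Z` a metrizable space, `f : ℝ × Y → Z` strongly measurable, `R > 0`.  Suppose `f` is INVARIANT UNDER EVERY DILATION
`t ↦ t∕s` (`s ≥ 1`) of the first variable, ALMOST EVERYWHERE on the slab `(0,R) × Y` — one null set PER `s` (this is what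
FILE B `…ConeLinkDilation` delivers for `(t,y) ↦ U(t•σ y)` and for the transported weak gradient).  Then there is a GOOD SLICE:
★★★ `exists_good_slice` — for any window `(a,b) ⊆ (0,R]` some `t₀ ∈ (a,b)` has `f (t,y) = f (t₀,y)` for a.e. `(t,y) ∈ (0,R) × Y`,
so `f` is a.e. equal to the `t`-free function `(t,y) ↦ f(t₀,y)` (whose slice `y ↦ f(t₀,y)` inherits every POINTWISE property
of `f`, e.g. unit norm).  Proof: Fubini swaps «for every `s`, a.e. `(t,y)`» into «a.e. `(t,y)`, a.e. `s`»; the map `s ↦ t∕s`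
sends null sets to null sets (`addHaar_image_eq_zero_of_differentiableOn_of_addHaar_eq_zero`), so for a.e. `(t,y)` the
function `τ ↦ f(τ,y)` equals `f(t,y)` for a.e. `τ ≤ t`; good `t`'s of this kind fill `(0,R)` up to a null set, any two of
them define the same slice function a.e. in `y`, and a sequence of them increasing to `R` exhausts the slab.  No density or
separability of test functions is used.

HONEST SCOPE.  Measure theory; nothing of (GAP)∕(TM), (C), S1″, K1, `MeanDeviationL`, `BlockLipschitzL`, `HistoryTailL` is
proved here.  YM₃ on T³ is rung R3, not Clay; YM gap NOT proved; no summit statement is proved here.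

References: L. Simon, Theorems on Regularity and Singularity of Energy Minimizing Maps (1996) [Simon1996] (§3.1, homogeneous
degree-zero extensions and their links); H. Federer, Geometric Measure Theory (1969) [Federer1969] (§2.6.2 Fubini).
-/

set_option autoImplicit false

noncomputable section

open MeasureTheory Set Function Filter Topology

namespace Summit.QuantumFields.YangMills.Theorems.PoincareLipschitzConeLinkSlice

variable {Y : Type*} [MeasureSpace Y] [SigmaFinite (volume : Measure Y)]
variable {Z : Type*} [TopologicalSpace Z] [TopologicalSpace.MetrizableSpace Z]

/-! ## §1 Points in positive-measure windows -/

omit [SigmaFinite (volume : Measure Y)] in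
/-- An a.e. property on `(0,R)` holds at some point of every window `(c,d) ⊆ (0,R)`. [folklore] -/
theorem exists_mem_Ioo_of_ae {P : ℝ → Prop} {R c d : ℝ} (hcd : c < d) (hsub : Ioo c d ⊆ Ioo 0 R)
    (h : ∀ᵐ t ∂(volume.restrict (Ioo 0 R)), P t) : ∃ t ∈ Ioo c d, P t := by
  have h1 : ∀ᵐ t ∂(volume.restrict (Ioo c d)), P t := ae_mono (Measure.restrict_mono hsub le_rfl) h
  have h2 : ∀ᵐ t ∂(volume.restrict (Ioo c d)), t ∈ Ioo c d := ae_restrict_mem measurableSet_Ioo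
  haveI : (ae (volume.restrict (Ioo c d))).NeBot := by
    rw [ae_neBot, Ne, Measure.restrict_eq_zero, Real.volume_Ioo]
    simp [hcd]
  obtain ⟨t, ht, hP⟩ := (h2.and h1).exists
  exact ⟨t, ht, hP⟩

/-! ## §2 From dilation invariance to invariance below almost every height -/

omit [MeasureSpace Y] [SigmaFinite (volume : Measure Y)] [TopologicalSpace Z] [TopologicalSpace.MetrizableSpace Z] in
/-- **Null sets go to null sets under `s ↦ t∕s`.**  If `f(t∕s, y) = f(t, y)` for a.e. `s ≥ 1`, then `f(τ, y) = f(t, y)` for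
a.e. `τ ∈ (0, t]` (`t > 0`). [folklore] -/
theorem ae_Ioc_of_ae_Ici {f : ℝ × Y → Z} {t : ℝ} (ht : 0 < t) {y : Y}
    (h : ∀ᵐ s ∂(volume.restrict (Ici (1:ℝ))), f (t / s, y) = f (t, y)) :
    ∀ᵐ τ ∂(volume.restrict (Ioc 0 t)), f (τ, y) = f (t, y) := by
  rw [ae_restrict_iff' measurableSet_Ici] at h
  rw [ae_restrict_iff' measurableSet_Ioc, ae_iff]
  -- the bad set of `s`
  set B : Set ℝ := {s | s ∈ Ici (1:ℝ) ∧ f (t / s, y) ≠ f (t, y)} with hB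
  have hB0 : volume B = 0 := by
    rw [ae_iff] at h
    have hsub : B ⊆ {a | ¬(a ∈ Ici (1:ℝ) → f (t / a, y) = f (t, y))} := fun s hs himp => hs.2 (himp hs.1)
    exact measure_mono_null hsub h
  have hdiff : DifferentiableOn ℝ (fun s : ℝ => t / s) B := by
    refine DifferentiableOn.div (differentiableOn_const t) differentiableOn_id fun s hs => ?_
    exact (lt_of_lt_of_le one_pos (mem_Ici.1 hs.1)).ne'
  have himg : volume ((fun s : ℝ => t / s) '' B) = 0 :=
    addHaar_image_eq_zero_of_differentiableOn_of_addHaar_eq_zero volume hdiff hB0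
  refine measure_mono_null (fun τ hτ => ?_) himg
  obtain ⟨⟨hτ0, hτt⟩, hne⟩ := Classical.not_imp.1 hτ
  refine ⟨t / τ, ⟨mem_Ici.2 ((one_le_div hτ0).2 hτt), ?_⟩, ?_⟩
  · show f (t / (t / τ), y) ≠ f (t, y)
    rwa [div_div_cancel₀ ht.ne']
  · show t / (t / τ) = τ
    rw [div_div_cancel₀ ht.ne']

omit [SigmaFinite (volume : Measure Y)] in
/-- Measurability of coincidence sets `{w | f (g₁ w) = f (g₂ w)}` for strongly measurable `f`. [folklore] -/
theorem measurableSet_eq_comp {W : Type*} [MeasurableSpace W] {f : ℝ × Y → Z} (hf : StronglyMeasurable f)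
    {g₁ g₂ : W → ℝ × Y} (hg₁ : Measurable g₁) (hg₂ : Measurable g₂) :
    MeasurableSet {w | f (g₁ w) = f (g₂ w)} :=
  (hf.comp_measurable hg₁).measurableSet_eq_fun (hf.comp_measurable hg₂)

omit [SigmaFinite (volume : Measure Y)] [TopologicalSpace Z] [TopologicalSpace.MetrizableSpace Z] [MeasureSpace Y] in
/-- `{x | p x → q x}` is measurable when `{p}` and `{q}` are. [folklore] -/
theorem measurableSet_imp {W : Type*} [MeasurableSpace W] {p q : W → Prop} (hp : MeasurableSet {x | p x})
    (hq : MeasurableSet {x | q x}) : MeasurableSet {x | p x → q x} := by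
  have h : {x | p x → q x} = {x | p x}ᶜ ∪ {x | q x} := by
    ext x; simp only [mem_setOf_eq, mem_union, mem_compl_iff, imp_iff_not_or]
  rw [h]
  exact hp.compl.union hq

/-! ## §3 Good slices -/

/-- ★★★ **GOOD SLICES.**  Let `f : ℝ × Y → Z` be strongly measurable (`Y` σ-finite, `Z` metrizable), `R > 0`, and suppose that
for every `s ≥ 1`, `f (t∕s, y) = f (t, y)` for a.e. `(t, y) ∈ (0,R) × Y`.  Then for every window `(a,b)`, `0 ≤ a < b ≤ R`, there
is `t₀ ∈ (a,b)` with `f (t, y) = f (t₀, y)` for a.e. `(t, y) ∈ (0,R) × Y`. [cite: Simon1996, §3.1 (homogeneous degree-zero maps and their links)] -/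
theorem exists_good_slice {f : ℝ × Y → Z} (hf : StronglyMeasurable f) {R : ℝ} (hR : 0 < R)
    (hinv : ∀ s : ℝ, 1 ≤ s →
      ∀ᵐ q ∂(volume.restrict (Ioo 0 R ×ˢ (univ : Set Y))), f (q.1 / s, q.2) = f q)
    {a b : ℝ} (ha : 0 ≤ a) (hab : a < b) (hbR : b ≤ R) :
    ∃ t₀ ∈ Ioo a b, ∀ᵐ q ∂(volume.restrict (Ioo 0 R ×ˢ (univ : Set Y))), f q = f (t₀, q.2) := by
  -- the slab measure as a product
  have hν : (volume.restrict (Ioo 0 R ×ˢ (univ : Set Y)) : Measure (ℝ × Y)) =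
      (volume.restrict (Ioo 0 R)).prod (volume : Measure Y) := by
    rw [show (volume : Measure (ℝ × Y)) = (volume : Measure ℝ).prod volume from rfl,
      ← Measure.prod_restrict, Measure.restrict_univ]
  -- Step 1: Fubini — for a.e. `q`, invariance under a.e. dilation
  have step1 : ∀ᵐ q ∂(volume.restrict (Ioo 0 R ×ˢ (univ : Set Y))),
      ∀ᵐ s ∂(volume.restrict (Ici (1:ℝ))), f (q.1 / s, q.2) = f q := by
    have hset : MeasurableSet {x : ℝ × (ℝ × Y) | f (x.2.1 / x.1, x.2.2) = f x.2} :=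
      measurableSet_eq_comp hf (g₁ := fun x : ℝ × (ℝ × Y) => (x.2.1 / x.1, x.2.2)) (g₂ := fun x => x.2)
        ((measurable_snd.fst.div measurable_fst).prodMk measurable_snd.snd) measurable_snd
    rw [← Measure.ae_ae_comm hset]
    rw [ae_restrict_iff' measurableSet_Ici]
    exact Filter.Eventually.of_forall fun s hs => hinv s hs
  -- Step 2: for a.e. `q`, `f(τ, q.2) = f q` for a.e. `τ ≤ q.1` (as an a.e. statement on `(0,R)`)
  have step2 : ∀ᵐ q ∂(volume.restrict (Ioo 0 R ×ˢ (univ : Set Y))),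
      ∀ᵐ τ ∂(volume.restrict (Ioo 0 R)), τ ≤ q.1 → f (τ, q.2) = f q := by
    filter_upwards [step1, ae_restrict_mem (measurableSet_Ioo.prod MeasurableSet.univ)] with q hq hqD
    have hq1 : 0 < q.1 := (mem_prod.1 hqD).1.1
    have h := ae_Ioc_of_ae_Ici (f := f) hq1 (y := q.2) (by simpa only [Prod.mk.eta] using hq)
    rw [ae_restrict_iff' measurableSet_Ioc] at h
    rw [ae_restrict_iff' measurableSet_Ioo]
    filter_upwards [h] with τ hτ hτR hτq
    exact hτ ⟨hτR.1, hτq⟩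
  -- Step 3: split `q = (t, y)`: almost every height `t` is GOOD
  have hgoodset : ∀ t : ℝ, MeasurableSet {q : ℝ × Y | q.1 ≤ t → f q = f (t, q.2)} := fun t =>
    measurableSet_imp (measurableSet_le measurable_fst measurable_const)
      (measurableSet_eq_comp hf (g₁ := fun q : ℝ × Y => q) (g₂ := fun q : ℝ × Y => (t, q.2))
        measurable_id (measurable_const.prodMk measurable_snd))
  have step3 : ∀ᵐ t ∂(volume.restrict (Ioo 0 R)),
      ∀ᵐ q ∂(volume.restrict (Ioo 0 R ×ˢ (univ : Set Y))), q.1 ≤ t → f q = f (t, q.2) := by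
    rw [hν] at step2 ⊢
    filter_upwards [Measure.ae_ae_of_ae_prod step2] with t ht
    have hsetA : MeasurableSet {x : Y × ℝ | x.2 ≤ t → f (x.2, x.1) = f (t, x.1)} :=
      measurableSet_imp (measurableSet_le measurable_snd measurable_const)
        (measurableSet_eq_comp hf (g₁ := fun x : Y × ℝ => (x.2, x.1)) (g₂ := fun x : Y × ℝ => (t, x.1))
          (measurable_snd.prodMk measurable_fst) (measurable_const.prodMk measurable_fst))
    have h4 := (Measure.ae_ae_comm (μ := (volume : Measure Y)) (ν := volume.restrict (Ioo 0 R))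
      (p := fun y τ => τ ≤ t → f (τ, y) = f (t, y)) hsetA).1 ht
    exact (Measure.ae_prod_iff_ae_ae (hgoodset t)).2 h4
  -- Step 4: a good height in the window, and good heights increasing to `R`
  have hab0 : Ioo a b ⊆ Ioo 0 R := Ioo_subset_Ioo ha hbR
  obtain ⟨t₀, ht₀ab, hgood₀⟩ := exists_mem_Ioo_of_ae hab hab0 step3
  have ht₀0 : 0 < t₀ := lt_of_le_of_lt ha ht₀ab.1
  have ht₀R : t₀ < R := lt_of_lt_of_le ht₀ab.2 hbR
  have hwin : ∀ k : ℕ, max t₀ (R - R / (k + 2)) < R := fun k =>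
    max_lt ht₀R (sub_lt_self R (by positivity))
  have hex : ∀ k : ℕ, ∃ t ∈ Ioo (max t₀ (R - R / (k + 2))) R,
      ∀ᵐ q ∂(volume.restrict (Ioo 0 R ×ˢ (univ : Set Y))), q.1 ≤ t → f q = f (t, q.2) := fun k =>
    exists_mem_Ioo_of_ae (hwin k) (Ioo_subset_Ioo (ht₀0.le.trans (le_max_left _ _)) le_rfl) step3
  choose tk htk hgoodk using hex
  -- Step 5: the slices at `t_k` and at `t₀` agree for a.e. `y`
  have hslice : ∀ k : ℕ, ∀ᵐ y ∂(volume : Measure Y), f (tk k, y) = f (t₀, y) := by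
    intro k
    have ht₀k : t₀ < tk k := lt_of_le_of_lt (le_max_left _ _) (htk k).1
    have h1 : ∀ᵐ q ∂(volume.restrict (Ioo 0 R ×ˢ (univ : Set Y))), q.1 ≤ t₀ → f (tk k, q.2) = f (t₀, q.2) := by
      filter_upwards [hgood₀, hgoodk k] with q h₀ hk hq
      rw [← hk (hq.trans ht₀k.le), h₀ hq]
    rw [hν] at h1
    obtain ⟨t, ht, hP⟩ := exists_mem_Ioo_of_ae ht₀0 (Ioo_subset_Ioo le_rfl ht₀R.le) (Measure.ae_ae_of_ae_prod h1)
    filter_upwards [hP] with y hy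
    exact hy ht.2.le
  -- Step 6: exhaust the slab
  refine ⟨t₀, ht₀ab, ?_⟩
  have hE : ∀ k : ℕ, ∀ᵐ q ∂(volume.restrict (Ioo 0 R ×ˢ (univ : Set Y))), q.1 ≤ tk k → f q = f (t₀, q.2) := by
    intro k
    have h2 : ∀ᵐ q ∂(volume.restrict (Ioo 0 R ×ˢ (univ : Set Y))), f (tk k, q.2) = f (t₀, q.2) := by
      rw [hν]
      exact (Measure.quasiMeasurePreserving_snd (μ := volume.restrict (Ioo 0 R)) (ν := (volume : Measure Y))).ae
        (hslice k)
    filter_upwards [hgoodk k, h2] with q hk h2 hq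
    rw [hk hq, h2]
  have hall := ae_all_iff.2 hE
  filter_upwards [hall, ae_restrict_mem (measurableSet_Ioo.prod MeasurableSet.univ)] with q hq hqD
  have hq1 : q.1 < R := (mem_prod.1 hqD).1.2
  -- choose `k` with `q.1 ≤ t_k`
  obtain ⟨k, hk⟩ : ∃ k : ℕ, R / (R - q.1) ≤ (k : ℝ) + 2 := by
    refine ⟨⌈R / (R - q.1)⌉₊, (Nat.le_ceil _).trans (by linarith)⟩
  have hRq : 0 < R - q.1 := sub_pos.2 hq1
  have h3 : R / ((k : ℝ) + 2) ≤ R - q.1 := by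
    rw [div_le_iff₀ (by positivity)]
    calc R = R / (R - q.1) * (R - q.1) := by field_simp
      _ ≤ ((k : ℝ) + 2) * (R - q.1) := by gcongr
      _ = (R - q.1) * ((k : ℝ) + 2) := mul_comm _ _
  refine hq k ?_
  have := (htk k).1
  have h4 : R - R / ((k : ℝ) + 2) ≤ tk k := (le_max_right _ _).trans this.le
  linarith

/-- ★★★ **ALMOST EVERY HEIGHT IS A GOOD SLICE.**  Under the hypotheses of `exists_good_slice`: for a.e. `t₀ ∈ (0,R)`,
`f (t, y) = f (t₀, y)` for a.e. `(t, y) ∈ (0,R) × Y` (so the consumer may intersect with any other a.e. condition on the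
height before choosing `t₀`: one good slice `t₁` exists, and `f(t₀,·) = f(t₁,·)` a.e. for a.e. `t₀` by Fubini). [cite: Simon1996, §3.1] -/
theorem ae_good_slice {f : ℝ × Y → Z} (hf : StronglyMeasurable f) {R : ℝ} (hR : 0 < R)
    (hinv : ∀ s : ℝ, 1 ≤ s →
      ∀ᵐ q ∂(volume.restrict (Ioo 0 R ×ˢ (univ : Set Y))), f (q.1 / s, q.2) = f q) :
    ∀ᵐ t₀ ∂(volume.restrict (Ioo 0 R)),
      ∀ᵐ q ∂(volume.restrict (Ioo 0 R ×ˢ (univ : Set Y))), f q = f (t₀, q.2) := by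
  have hν : (volume.restrict (Ioo 0 R ×ˢ (univ : Set Y)) : Measure (ℝ × Y)) =
      (volume.restrict (Ioo 0 R)).prod (volume : Measure Y) := by
    rw [show (volume : Measure (ℝ × Y)) = (volume : Measure ℝ).prod volume from rfl,
      ← Measure.prod_restrict, Measure.restrict_univ]
  obtain ⟨t₁, -, h1⟩ := exists_good_slice hf hR hinv le_rfl hR le_rfl
  have h2 : ∀ᵐ t₀ ∂(volume.restrict (Ioo 0 R)), ∀ᵐ y ∂(volume : Measure Y), f (t₀, y) = f (t₁, y) := by
    have h := h1
    rw [hν] at h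
    exact Measure.ae_ae_of_ae_prod h
  filter_upwards [h2] with t₀ ht₀
  have h3 : ∀ᵐ q ∂(volume.restrict (Ioo 0 R ×ˢ (univ : Set Y))), f (t₀, q.2) = f (t₁, q.2) := by
    rw [hν]
    exact (Measure.quasiMeasurePreserving_snd (μ := volume.restrict (Ioo 0 R)) (ν := (volume : Measure Y))).ae ht₀
  filter_upwards [h1, h3] with q hq hq3
  rw [hq, hq3]

end Summit.QuantumFields.YangMills.Theorems.PoincareLipschitzConeLinkSlice

end
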